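import Summits.ResolutionOfSingularities.ResolutionOfSingularities.Theorems.HilbertSamuelEliminationSigmaMaxModificationsCorridor3TameStratumComponents
import Literature.AlgebraicGeometry.Motives.SubschemeCyclesFlatPullbackProofs
import Literature.AlgebraicGeometry.Resolution.SigmaMaxEliminationInDim
import HarnessLib

/-!
# Route `HilbertSamuelElimination`, crux `SigmaMaxModificationsCorridor3`
# (stmt-ResolutionOfSingularities-19249; child of `SigmaMaxModifications` stmt-…-18506),
# line `tame_wild`: helper **T-ψ**, part 2 — a tame Hilbert–Samuel stratum splits off the
# lower-dimensional components

[OURS · L1 W4.2] Helper T-ψ of `L/w42/CHAIN.md` v2 (interim assignment of plan-1,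
2026-08-26T20:30Z: "tame `ν` ⇒ `Y(ν) = S₂ ⊔ S₃` clopen, `Y` locally of dimension `2` along `S₂`"),
the input of the `ν`-gluing v2 of the tame line (local `ν`-witnesses over opens with DISJOINT
traces on the stratum). NOT a statement of any manuscript.

Let `Y` be locally of finite type and quasi-compact over a field `k`, `dim Y ≤ N`, and
`ν = hypersurfaceHFe (N+1) m` with `m ≥ 2` (at `N = 3`: a tame value `hypersurfaceHF m ≠ Φ^{(3)}`).
By part 1 (`…Corridor3TameStratumComponents.lean`, `height_eq_height_of_mem_hsStratum`) all
irreducible components of `Y` through a point of `Y(ν)` have the same dimension. Hence: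

* `exists_opens_split_hsStratum_hypersurfaceHFe` — **the split**: there are DISJOINT opens
  `U, V ⊆ Y` with `Y(ν) ⊆ U ∪ V`, `dim U ≤ N - 1` (`U` = complement of the `N`-dimensional
  components: at `N = 3` the regime of the printed surface theorem) and `V` purely
  `N`-dimensional (`V` = complement of the components of dimension `< N`: every component of `Y`
  through a point of `V` has dimension `N`); the traces `Y(ν) ∩ U`, `Y(ν) ∩ V` are the clopen
  pieces `S_{<N} ⊔ S_N` of the stratum. `exists_opens_split_hsStratum_hypersurfaceHF`,
  `exists_opens_split_hsStratum_of_isTameValue`: the same at `N = 3` in the frame of the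
  registered stub `stub_tameNu3_ge5`.
* `hsPsi_add_height_eq_of_mem_inter`, `hsPsi_eq_of_isClosed_of_mem_inter`,
  `hilbertFun_stalk_one_eq_of_isClosed_of_mem_inter`,
  `exists_stalk_ringEquiv_of_isClosed_of_mem_inter` — on `V ∩ Y(ν)`: `ψ_Y(y) + dim cl{y} = N`; at
  its closed points `ψ_Y(y) = N`, `emb.dim 𝒪_{Y,y} = N + 1` and `𝒪_{Y,y} ≅ R/(g)` with `R` regular
  local of dimension `N + 1`, `g` of order `m` (the input of the re-embedding of `Y` near `S_N` as
  a hypersurface of a smooth `(N+1)`-fold, helper T-emb); on `U ∩ Y(ν)`: `ψ_Y(y) + dim cl{y} < N`.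

* `stub_Teqd_quotient_span_singleton_equidim`, `stub_Tpsi_hypersurface_stratum_split` — the
  planner's typed signatures of T-eqd / T-ψ (`L/w42/helpers-v2.lean`) verbatim, as corollaries;
  `ringKrullDim_stalk_eq_of_isClosed_of_mem_inter` — `dim 𝒪_{Y,y} = N` at the closed points of
  `V ∩ Y(ν)`.

Remark (for the record of the chain): "`ψ ∈ {2, 3}` on a tame stratum of a threefold" holds at
CLOSED points only up to isolated points lying on CURVE components (`Y = 𝔸³ ⊔` a nodal plane
curve, `ν = hypersurfaceHF 2`: the node has `ψ = 1`); these lie in `U`, where `dim ≤ 2`.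

## Sources

* V. Cossart, U. Jannsen, S. Saito, LNM 2270 (2020): Def. 2.28, Def. 2.35, Lemma 2.23,
  Rem. 6.29. [CossartJannsenSaito2020]
* The Stacks Project, Tags 0A21 (dimension theory of schemes locally of finite type over a
  field), 0BE1 (finitely many irreducible components). [StacksProject]
-/

set_option linter.dupNamespace false -- mandated namespace of this single-conjunct summit

noncomputable section

open CategoryTheory AlgebraicGeometry TopologicalSpace Topology Order IsLocalRing
open Literature.RingTheory.HilbertSamuel Literature.AlgebraicGeometry.Resolution
open Summit.ResolutionOfSingularities.ResolutionOfSingularities.Theorems.SigmaMaxModificationsCorridor3.TameWild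

namespace Summit.ResolutionOfSingularities.ResolutionOfSingularities.Theorems.SigmaMaxModificationsCorridor3.Helpers

/-! ## The split of a tame stratum -/

/-- **T-ψ: a tame Hilbert–Samuel stratum splits off the lower-dimensional components.** Let `Y`
be locally of finite type and quasi-compact over a field `k`, `dim Y ≤ N`, `m ≥ 2`,
`ν = hypersurfaceHFe (N+1) m` (at `N = 3`: a tame value `hypersurfaceHF m ≠ Φ^{(3)}`). Put
`U := Y ∖ ⋃ {cl{η} : η maximal, dim cl{η} ≥ N}` and `V := Y ∖ ⋃ {cl{η} : η maximal, dim cl{η} < N}`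
(finite unions of irreducible components — `Y` is Noetherian). Then `U, V` are DISJOINT opens,
`dim U ≤ N - 1`, every component of `Y` through a point of `V` has dimension `N`, and
**`Y(ν) ⊆ U ∪ V`**: a point of `Y(ν)` on an `N`-dimensional component lies on no component of
smaller dimension (`height_eq_height_of_mem_hsStratum`). So `Y(ν) = (Y(ν) ∩ U) ⊔ (Y(ν) ∩ V)` with
both pieces open (and closed) in `Y(ν)`. [OURS · L1 W4.2] helper T-ψ; NOT a statement of the
manuscript. [cite: StacksProject, Tag 0A21] [cite: CossartJannsenSaito2020, Def. 2.28, Def. 2.35] -/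
theorem exists_opens_split_hsStratum_hypersurfaceHFe {k : Type} [Field k] {Y : Scheme.{0}}
    (f : Y ⟶ Spec (.of k)) [LocallyOfFiniteType f] [QuasiCompact f] {N : ℕ}
    (hdim : topologicalKrullDim Y ≤ (N : WithBot ℕ∞)) {m : ℕ} (hm : 2 ≤ m) :
    ∃ U V : Y.Opens, Disjoint U V ∧
      Scheme.hsStratum Y N (hypersurfaceHFe (N + 1) m) ⊆ (U : Set Y) ∪ (V : Set Y) ∧
      topologicalKrullDim (U : Scheme.{0}) ≤ ((N - 1 : ℕ) : WithBot ℕ∞) ∧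
      (∀ v ∈ (V : Set Y), ∀ η : Y, IsMax η → η ⤳ v → height η = N) ∧
      (∀ u ∈ (U : Set Y), ∀ η : Y, IsMax η → η ⤳ u → height η < N) := by
  haveI : IsLocallyNoetherian Y := LocallyOfFiniteType.isLocallyNoetherian f
  haveI : CompactSpace Y := QuasiCompact.compactSpace_of_compactSpace f
  -- the finitely many maximal points
  have hfin : {η : Y | IsMax η}.Finite := by
    have h := Literature.AlgebraicGeometry.Motives.finite_setOf_mem_and_isMax (W := Y) ⊤
      (by simpa using isCompact_univ)
    exact h.subset fun η hη => ⟨trivial, hη⟩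
  -- heights are bounded by `N`
  have hle : ∀ x : Y, height x ≤ (N : ℕ∞) := fun x => by
    have h := (height_le_topologicalKrullDim x).trans hdim
    exact_mod_cast h
  -- the two closed sets
  set Top : Set Y := {η : Y | IsMax η ∧ (N : ℕ∞) ≤ height η} with hTop
  set Low : Set Y := {η : Y | IsMax η ∧ height η < (N : ℕ∞)} with hLow
  have hTopfin : Top.Finite := hfin.subset fun η hη => hη.1
  have hLowfin : Low.Finite := hfin.subset fun η hη => hη.1
  set CT : Set Y := ⋃ η ∈ Top, closure {η} with hCT
  set CL : Set Y := ⋃ η ∈ Low, closure {η} with hCL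
  have hCTc : IsClosed CT := hTopfin.isClosed_biUnion fun _ _ => isClosed_closure
  have hCLc : IsClosed CL := hLowfin.isClosed_biUnion fun _ _ => isClosed_closure
  let U : Y.Opens := ⟨CTᶜ, hCTc.isOpen_compl⟩
  let V : Y.Opens := ⟨CLᶜ, hCLc.isOpen_compl⟩
  have hUmem : ∀ {u : Y}, u ∈ (U : Set Y) ↔ ∀ η : Y, IsMax η → η ⤳ u → height η < N := by
    intro u
    change u ∈ CTᶜ ↔ _
    simp only [hCT, Set.mem_compl_iff, Set.mem_iUnion, exists_prop, not_exists, not_and, hTop,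
      Set.mem_setOf_eq]
    constructor
    · intro hu η hη hηu
      by_contra hlt
      exact hu η ⟨hη, not_lt.mp hlt⟩ hηu.mem_closure
    · rintro hu η ⟨hη, hN⟩ hmem
      exact absurd hN (not_le.mpr (hu η hη (specializes_iff_mem_closure.mpr hmem)))
  have hVmem : ∀ {v : Y}, v ∈ (V : Set Y) ↔ ∀ η : Y, IsMax η → η ⤳ v → height η = N := by
    intro v
    change v ∈ CLᶜ ↔ _
    simp only [hCL, Set.mem_compl_iff, Set.mem_iUnion, exists_prop, not_exists, not_and, hLow,
      Set.mem_setOf_eq]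
    constructor
    · intro hv η hη hηv
      refine le_antisymm (hle η) ?_
      by_contra hlt
      exact hv η ⟨hη, not_le.mp hlt⟩ hηv.mem_closure
    · rintro hv η ⟨hη, hN⟩ hmem
      exact absurd (hv η hη (specializes_iff_mem_closure.mpr hmem)) (ne_of_lt hN)
  refine ⟨U, V, ?_, ?_, ?_, fun v hv => hVmem.mp hv, fun u hu => hUmem.mp hu⟩
  · -- disjoint: every point lies under some maximal point, of height `< N` or `= N`
    rw [disjoint_iff, Opens.ext_iff]
    ext x
    simp only [Opens.coe_inf, Set.mem_inter_iff, Opens.coe_bot, Set.mem_empty_iff_false,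
      iff_false, not_and]
    intro hxU hxV
    obtain ⟨η, hη, hηx⟩ := exists_isMax_specializes' x
    exact absurd (hVmem.mp hxV η hη hηx) (ne_of_lt (hUmem.mp hxU η hη hηx))
  · -- the stratum is covered
    intro y hy
    by_cases hyU : y ∈ (U : Set Y)
    · exact Or.inl hyU
    · refine Or.inr (hVmem.mpr fun η hη hηy => ?_)
      -- `y ∉ U`: some maximal `η₀ ⤳ y` has height `N`; all components through `y` agree
      obtain ⟨η₀, hη₀, hη₀y, hN⟩ : ∃ η₀ : Y, IsMax η₀ ∧ η₀ ⤳ y ∧ height η₀ = N := by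
        by_contra hne
        push Not at hne
        exact hyU (hUmem.mpr fun η hη hηy => lt_of_le_of_ne (hle η) (hne η hη hηy))
      have hψ : Scheme.hsPsi Y y ≤ N := Scheme.hsPsi_le_of_topologicalKrullDim_le hdim y
      rw [height_eq_height_of_mem_hsStratum f hm hψ hy hηy hη hη₀y hη₀, hN]
  · -- `dim U ≤ N - 1`: a chain of length `≥ N` in `U` ends on an `N`-dimensional component
    rw [show topologicalKrullDim (U : Scheme.{0}) = krullDim (U : Scheme.{0}) from
      krullDim_eq_of_orderIso (irreducibleSetEquivPoints (α := (U : Scheme.{0})))]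
    refine iSup_le fun s => ?_
    have hmono : StrictMono (fun a : (U : Scheme.{0}) => U.ι.base a) := by
      intro a b hab
      simp only [lt_iff_le_not_ge, Scheme.le_iff_specializes] at hab ⊢
      refine ⟨hab.1.map U.ι.continuous, fun hba => hab.2 ?_⟩
      exact U.ι.isOpenEmbedding.isInducing.specializes_iff.mp hba
    -- the top of the chain, read in `Y`, lies in `U` under a maximal point `η`
    have hlastU : U.ι.base s.last ∈ (U : Set Y) := (s.last).2
    obtain ⟨η, hη, hηs⟩ := exists_isMax_specializes' (U.ι.base s.last)
    have hlen : (s.length : ℕ∞) ≤ height η :=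
      calc (s.length : ℕ∞) ≤ height s.last := length_le_height_last
        _ ≤ height (U.ι.base s.last) := height_le_height_apply_of_strictMono _ hmono _
        _ ≤ height η := height_mono (Scheme.le_iff_specializes.mpr hηs)
    have hlt : height η < N := hUmem.mp hlastU η hη hηs
    have h : (s.length : ℕ∞) < N := hlen.trans_lt hlt
    have h' : s.length < N := by exact_mod_cast h
    exact_mod_cast (show s.length ≤ N - 1 by omega)

/-! ## Reading the split at the points of the stratum -/

/-- On the purely top-dimensional piece: for `y ∈ V ∩ Y(ν)` (with `V` as in
`exists_opens_split_hsStratum_hypersurfaceHFe`, i.e. every component of `Y` through a point of `V`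
has dimension `N`), `ψ_Y(y) + dim cl{y} = N`. [OURS · L1 W4.2] helper T-ψ; NOT a statement of the
manuscript. [cite: StacksProject, Tag 0A21] [cite: CossartJannsenSaito2020, Def. 2.28] -/
theorem hsPsi_add_height_eq_of_mem_inter {k : Type} [Field k] {Y : Scheme.{0}}
    (f : Y ⟶ Spec (.of k)) [LocallyOfFiniteType f] {N m : ℕ} (hm : 2 ≤ m)
    (hdim : topologicalKrullDim Y ≤ (N : WithBot ℕ∞)) {V : Set Y}
    (hV : ∀ v ∈ V, ∀ η : Y, IsMax η → η ⤳ v → height η = N) {y : Y}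
    (hy : y ∈ V ∩ Scheme.hsStratum Y N (hypersurfaceHFe (N + 1) m)) :
    (Scheme.hsPsi Y y : ℕ∞) + height y = N := by
  haveI : IsLocallyNoetherian Y := LocallyOfFiniteType.isLocallyNoetherian f
  have hψ : Scheme.hsPsi Y y ≤ N := Scheme.hsPsi_le_of_topologicalKrullDim_le hdim y
  obtain ⟨η, hη, hηy⟩ := exists_isMax_specializes' y
  rw [← height_eq_hsPsi_add_height_of_mem_hsStratum f hm hψ hy.2 hηy hη, hV y hy.1 η hη hηy]

/-- On the lower-dimensional piece: for `y ∈ U ∩ Y(ν)` (every component through a point of `U`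
has dimension `< N`), `ψ_Y(y) + dim cl{y} < N`. [OURS · L1 W4.2] helper T-ψ; NOT a statement of
the manuscript. [cite: StacksProject, Tag 0A21] [cite: CossartJannsenSaito2020, Def. 2.28] -/
theorem hsPsi_add_height_lt_of_mem_inter {k : Type} [Field k] {Y : Scheme.{0}}
    (f : Y ⟶ Spec (.of k)) [LocallyOfFiniteType f] {N m : ℕ} (hm : 2 ≤ m)
    (hdim : topologicalKrullDim Y ≤ (N : WithBot ℕ∞)) {U : Set Y}
    (hU : ∀ u ∈ U, ∀ η : Y, IsMax η → η ⤳ u → height η < N) {y : Y}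
    (hy : y ∈ U ∩ Scheme.hsStratum Y N (hypersurfaceHFe (N + 1) m)) :
    (Scheme.hsPsi Y y : ℕ∞) + height y < N := by
  haveI : IsLocallyNoetherian Y := LocallyOfFiniteType.isLocallyNoetherian f
  have hψ : Scheme.hsPsi Y y ≤ N := Scheme.hsPsi_le_of_topologicalKrullDim_le hdim y
  obtain ⟨η, hη, hηy⟩ := exists_isMax_specializes' y
  rw [← height_eq_hsPsi_add_height_of_mem_hsStratum f hm hψ hy.2 hηy hη]
  exact hU y hy.1 η hη hηy

/-- **At a CLOSED point of the purely top-dimensional piece of a tame stratum, `ψ_Y(y) = N`**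
(so `φ = 0` and `H^N_Y(y) = H^{(0)}(𝒪_{Y,y})`). [OURS · L1 W4.2] helper T-ψ; NOT a statement of the
manuscript. [cite: StacksProject, Tag 0A21] [cite: CossartJannsenSaito2020, Def. 2.28] -/
theorem hsPsi_eq_of_isClosed_of_mem_inter {k : Type} [Field k] {Y : Scheme.{0}}
    (f : Y ⟶ Spec (.of k)) [LocallyOfFiniteType f] {N m : ℕ} (hm : 2 ≤ m)
    (hdim : topologicalKrullDim Y ≤ (N : WithBot ℕ∞)) {V : Set Y}
    (hV : ∀ v ∈ V, ∀ η : Y, IsMax η → η ⤳ v → height η = N) {y : Y}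
    (hy : y ∈ V ∩ Scheme.hsStratum Y N (hypersurfaceHFe (N + 1) m))
    (hcl : IsClosed ({y} : Set Y)) : Scheme.hsPsi Y y = N := by
  have h := hsPsi_add_height_eq_of_mem_inter f hm hdim hV hy
  -- a closed point has height `0` (cf. `Literature.AlgebraicGeometry.Motives.ProjFamily.height_eq_zero_of_isClosed_singleton`)
  have h0 : height y = 0 := by
    refine height_eq_zero.mpr fun z hz => ?_
    have hyz : y ⤳ z := Scheme.le_iff_specializes.mp hz
    have hzy : z = y := Set.mem_singleton_iff.mp (hyz.mem_closed hcl (Set.mem_singleton y))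
    exact hzy ▸ le_rfl
  rw [h0, add_zero] at h
  exact_mod_cast h

/-- **Embedding dimension `N + 1` at the closed points of the purely top-dimensional piece of a
tame stratum**: `H^{(0)}(𝒪_{Y,y})(1) = N + 1` (so, at `N = 3`, `𝒪_{Y,y} ≅ R/(g)` with `R` regular
local of dimension `4` — the hypersurface-of-a-fourfold chart of the tame line).
[OURS · L1 W4.2] helper T-ψ; NOT a statement of the manuscript.
[cite: CossartJannsenSaito2020, Def. 2.28, Thm. 2.3] -/
theorem hilbertFun_stalk_one_eq_of_isClosed_of_mem_inter {k : Type} [Field k] {Y : Scheme.{0}}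
    (f : Y ⟶ Spec (.of k)) [LocallyOfFiniteType f] {N m : ℕ} (hm : 2 ≤ m)
    (hdim : topologicalKrullDim Y ≤ (N : WithBot ℕ∞)) {V : Set Y}
    (hV : ∀ v ∈ V, ∀ η : Y, IsMax η → η ⤳ v → height η = N) {y : Y}
    (hy : y ∈ V ∩ Scheme.hsStratum Y N (hypersurfaceHFe (N + 1) m))
    (hcl : IsClosed ({y} : Set Y)) : hilbertFun (Y.presheaf.stalk y) 1 = N + 1 := by
  haveI : IsLocallyNoetherian Y := LocallyOfFiniteType.isLocallyNoetherian f
  have hψ : Scheme.hsPsi Y y ≤ N := Scheme.hsPsi_le_of_topologicalKrullDim_le hdim y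
  rw [hilbertFun_stalk_one_of_mem_hsStratum hψ hm hy.2, hsPsi_eq_of_isClosed_of_mem_inter f hm hdim hV hy hcl]

/-- **The hypersurface-of-an-`(N+1)`-fold presentation at the closed points of the purely
top-dimensional piece**: `𝒪_{Y,y} ≅ R/(g)` with `R` regular local of dimension `N + 1` and `g` of
order exactly `m`. [OURS · L1 W4.2] helper T-ψ; NOT a statement of the manuscript.
[cite: CossartJannsenSaito2020, Def. 2.28, §2.2 (p. 27)] -/
theorem exists_stalk_ringEquiv_of_isClosed_of_mem_inter {k : Type} [Field k] {Y : Scheme.{0}}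
    (f : Y ⟶ Spec (.of k)) [LocallyOfFiniteType f] {N m : ℕ} (hm : 2 ≤ m)
    (hdim : topologicalKrullDim Y ≤ (N : WithBot ℕ∞)) {V : Set Y}
    (hV : ∀ v ∈ V, ∀ η : Y, IsMax η → η ⤳ v → height η = N) {y : Y}
    (hy : y ∈ V ∩ Scheme.hsStratum Y N (hypersurfaceHFe (N + 1) m))
    (hcl : IsClosed ({y} : Set Y)) :
    ∃ (R : Type) (_ : CommRing R) (_ : IsRegularLocalRing R) (g : R),
      ringKrullDim R = (N + 1 : ℕ) ∧ g ∈ maximalIdeal R ^ m ∧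
      g ∉ maximalIdeal R ^ (m + 1) ∧ Nonempty (Y.presheaf.stalk y ≃+* R ⧸ Ideal.span {g}) := by
  haveI : IsLocallyNoetherian Y := LocallyOfFiniteType.isLocallyNoetherian f
  have hψ : Scheme.hsPsi Y y ≤ N := Scheme.hsPsi_le_of_topologicalKrullDim_le hdim y
  have h := exists_stalk_ringEquiv_of_mem_hsStratum f hm hψ hy.2
  rwa [hsPsi_eq_of_isClosed_of_mem_inter f hm hdim hV hy hcl] at h

/-! ## The tame line at level `3` -/

/-- **T-ψ for the tame line (`N = 3`).** For `Y` locally of finite type and quasi-compact over a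
field with `dim Y ≤ 3` and a value `ν = hypersurfaceHF m`, `m ≥ 2` (every tame maximal value
`≠ Φ^{(3)}`, `two_le_of_isTameValue_of_mem_hsValues`): disjoint opens `U ⊇ S_{≤2}`, `V ⊇ S₃` with
`Y(ν) ⊆ U ∪ V`, `dim U ≤ 2` (the printed CJS surface regime) and `V` purely three-dimensional.
[OURS · L1 W4.2] helper T-ψ of CHAIN v2; NOT a statement of the manuscript.
[cite: CossartJannsenSaito2020, Def. 2.28, Def. 2.35, Rem. 6.29] -/
theorem exists_opens_split_hsStratum_hypersurfaceHF {k : Type} [Field k] {Y : Scheme.{0}}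
    (f : Y ⟶ Spec (.of k)) [LocallyOfFiniteType f] [QuasiCompact f]
    (hdim : topologicalKrullDim Y ≤ ((3 : ℕ) : WithBot ℕ∞)) {m : ℕ} (hm : 2 ≤ m) :
    ∃ U V : Y.Opens, Disjoint U V ∧
      Scheme.hsStratum Y 3 (hypersurfaceHF m) ⊆ (U : Set Y) ∪ (V : Set Y) ∧
      topologicalKrullDim (U : Scheme.{0}) ≤ ((2 : ℕ) : WithBot ℕ∞) ∧
      (∀ v ∈ (V : Set Y), ∀ η : Y, IsMax η → η ⤳ v → height η = 3) ∧
      (∀ u ∈ (U : Set Y), ∀ η : Y, IsMax η → η ⤳ u → height η < 3) := by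
  rw [← hypersurfaceHFe_four]
  exact exists_opens_split_hsStratum_hypersurfaceHFe f hdim hm

/-- **T-ψ in the frame of the registered stub `stub_tameNu3_ge5`.** For a `p`-tame value
`ν ≠ Φ^{(3)}` of `Σ_Y(3)` (`ν = hypersurfaceHF m`, `2 ≤ m < p`,
`two_le_of_isTameValue_of_mem_hsValues`) on `Y` locally of finite type and quasi-compact over a
field with `dim Y ≤ 3`: the stratum `Y(ν)` is covered by two DISJOINT opens, `U` of dimension
`≤ 2` and `V` purely three-dimensional. [OURS · L1 W4.2] helper T-ψ of CHAIN v2; NOT a statement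
of the manuscript. [cite: CossartJannsenSaito2020, Def. 2.28, Lemma 2.23, Rem. 6.29] -/
theorem exists_opens_split_hsStratum_of_isTameValue {k : Type} [Field k] {Y : Scheme.{0}}
    (f : Y ⟶ Spec (.of k)) [LocallyOfFiniteType f] [QuasiCompact f]
    (hdim : topologicalKrullDim Y ≤ ((3 : ℕ) : WithBot ℕ∞)) {p : ℕ} {ν : ℕ → ℕ}
    (hν : ν ∈ Scheme.hsValues Y 3) (hνΦ : ν ≠ iterPSum 3 Phi) (ht : IsTameValue p ν) :
    ∃ U V : Y.Opens, Disjoint U V ∧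
      Scheme.hsStratum Y 3 ν ⊆ (U : Set Y) ∪ (V : Set Y) ∧
      topologicalKrullDim (U : Scheme.{0}) ≤ ((2 : ℕ) : WithBot ℕ∞) ∧
      (∀ v ∈ (V : Set Y), ∀ η : Y, IsMax η → η ⤳ v → height η = 3) ∧
      (∀ u ∈ (U : Set Y), ∀ η : Y, IsMax η → η ⤳ u → height η < 3) := by
  haveI : IsLocallyNoetherian Y := LocallyOfFiniteType.isLocallyNoetherian f
  obtain ⟨m, hm, -, rfl⟩ := two_le_of_isTameValue_of_mem_hsValues hν hνΦ ht
  exact exists_opens_split_hsStratum_hypersurfaceHF f hdim hm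

/-! ## The planner's typed signatures (`L/w42/CHAIN.md` v2 §4, `L/w42/helpers-v2.lean`), by name -/

/-- **The local dimension at a closed point of the purely top-dimensional piece of a tame stratum
is `N`**: `ψ_Y(y) ≤ dim 𝒪_{Y,y} ≤ dim Y ≤ N` and `ψ_Y(y) = N`
(`hsPsi_eq_of_isClosed_of_mem_inter`). [OURS · L1 W4.2] helper T-ψ; NOT a statement of the
manuscript. [cite: StacksProject, Tag 0A21] [cite: CossartJannsenSaito2020, Def. 2.28] -/
theorem ringKrullDim_stalk_eq_of_isClosed_of_mem_inter {k : Type} [Field k] {Y : Scheme.{0}}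
    (f : Y ⟶ Spec (.of k)) [LocallyOfFiniteType f] {N m : ℕ} (hm : 2 ≤ m)
    (hdim : topologicalKrullDim Y ≤ (N : WithBot ℕ∞)) {V : Set Y}
    (hV : ∀ v ∈ V, ∀ η : Y, IsMax η → η ⤳ v → height η = N) {y : Y}
    (hy : y ∈ V ∩ Scheme.hsStratum Y N (hypersurfaceHFe (N + 1) m))
    (hcl : IsClosed ({y} : Set Y)) : ringKrullDim (Y.presheaf.stalk y) = (N : WithBot ℕ∞) := by
  haveI : IsLocallyNoetherian Y := LocallyOfFiniteType.isLocallyNoetherian f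
  have hψ : Scheme.hsPsi Y y = N := hsPsi_eq_of_isClosed_of_mem_inter f hm hdim hV hy hcl
  refine le_antisymm
    ((SigmaMaxModifications.Negative.ringKrullDim_stalk_le_topologicalKrullDim' Y y).trans hdim) ?_
  have h : (Scheme.hsPsi Y y : WithBot ℕ∞) ≤ ringKrullDim (Y.presheaf.stalk y) :=
    minimalPrimesCodim_le_ringKrullDim (Y.presheaf.stalk y)
  rwa [hψ] at h

/-- **T-eqd** (plan-1's typed signature, `L/w42/helpers-v2.lean`, verbatim): a hypersurface
quotient of a regular local ring is equidimensional — every minimal prime of `R ⧸ (g)` has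
coheight `dim R - 1`. A renaming of `ringKrullDim_quotient_of_mem_minimalPrimes_quotient_span_singleton`
(part 1, `…Corridor3TameStratumComponents.lean`); the hypothesis `g ∈ 𝔪` of the typed signature is
not needed. [OURS · L1 W4.2] helper of CHAIN v2; NOT a statement of the manuscript.
[cite: Matsumura1987, §5 (p. 31), Thm. 17.4] -/
theorem stub_Teqd_quotient_span_singleton_equidim (R : Type) [CommRing R] [IsRegularLocalRing R]
    (n : ℕ) (hR : ringKrullDim R = (n + 1 : ℕ)) (g : R) (_hg : g ∈ IsLocalRing.maximalIdeal R)
    (hg0 : g ≠ 0) :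
    ∀ 𝔭 ∈ minimalPrimes (R ⧸ Ideal.span {g}),
      ringKrullDim ((R ⧸ Ideal.span {g}) ⧸ 𝔭) = (n : ℕ) := by
  intro 𝔭 h𝔭
  rw [ringKrullDim_quotient_of_mem_minimalPrimes_quotient_span_singleton hR hg0 h𝔭, Nat.add_sub_cancel]

/-- **T-ψ** (plan-1's typed signature, `L/w42/helpers-v2.lean`, verbatim): **hypersurface strata
do not straddle components of different dimensions.** For `Y/k` reduced, locally of finite type
and quasi-compact, `dim Y ≤ 3`, and a hypersurface value `ν = hypersurfaceHF m`, `2 ≤ m`, the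
stratum `Y(ν)` (level `3`) is covered by two DISJOINT opens: `U₂` of dimension `≤ 2` (the complement
of the `3`-dimensional irreducible components) and `U₃` (the complement of the components of
dimension `≤ 2`), and at the closed points of `Y(ν) ∩ U₃` the local ring has dimension `3`. A
repackaging of `exists_opens_split_hsStratum_hypersurfaceHF` and
`ringKrullDim_stalk_eq_of_isClosed_of_mem_inter` (reducedness is not needed). [OURS · L1 W4.2]
helper of CHAIN v2, consumed by the ν-gluing v2 (G2); NOT a statement of the manuscript.
[cite: CossartJannsenSaito2020, Def. 2.28, Thm. 2.33, Lemma 2.23] [cite: StacksProject, Tag 0A21] -/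
theorem stub_Tpsi_hypersurface_stratum_split (k : Type) [Field k] (Y : Scheme.{0})
    (g : Y ⟶ Spec (.of k)) [LocallyOfFiniteType g] [QuasiCompact g] [IsReduced Y]
    (hY : topologicalKrullDim Y ≤ ((3 : ℕ) : WithBot ℕ∞)) (ν : ℕ → ℕ) (m : ℕ) (hm : 2 ≤ m)
    (hν : ν = hypersurfaceHF m) :
    ∃ U₂ U₃ : Y.Opens, Scheme.hsStratum Y 3 ν ⊆ (U₂ : Set Y) ∪ (U₃ : Set Y) ∧
      (U₂ : Set Y) ∩ (U₃ : Set Y) = ∅ ∧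
      topologicalKrullDim (U₂ : Scheme.{0}) ≤ ((2 : ℕ) : WithBot ℕ∞) ∧
      ∀ y : Y, y ∈ (U₃ : Set Y) → y ∈ Scheme.hsStratum Y 3 ν → IsClosed ({y} : Set Y) →
        ringKrullDim (Y.presheaf.stalk y) = ((3 : ℕ) : WithBot ℕ∞) := by
  subst hν
  obtain ⟨U, V, hUV, hcov, hdimU, hV, -⟩ := exists_opens_split_hsStratum_hypersurfaceHF g hY hm
  refine ⟨U, V, hcov, ?_, hdimU, fun y hyV hy hcl => ?_⟩
  · have h := congrArg (fun W : Y.Opens => (W : Set Y)) (disjoint_iff.mp hUV)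
    simpa only [Opens.coe_inf, Opens.coe_bot] using h
  · rw [← hypersurfaceHFe_four] at hy
    exact ringKrullDim_stalk_eq_of_isClosed_of_mem_inter g hm hY hV ⟨hyV, hy⟩ hcl

end Summit.ResolutionOfSingularities.ResolutionOfSingularities.Theorems.SigmaMaxModificationsCorridor3.Helpers

end
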